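import Summits.HodgeConjecture.HodgeConjecture.Theorems.Ring2MotivProductCells
import Literature.AlgebraicGeometry.HodgeTheory.HodgeGroupProductCMFactorDiscOne
import HarnessLib

/-!
# Ring 2 / motiv (gen 5): the product cells `𝒜 × (CM ∩ DiscOneWeilPower)` — summit twin of Literature Part VI: on these cells the hypothesis HC_CM is ABSENT (its instance is Floccari–Fu's theorem), and the cell is EXACTLY as hard as HC on `𝒜`

HONEST FRAMING (page 1, verbatim): research route conditional on HC_CM; not a corollary;
Q11.4-sentence-2 already refuted in dim ≥ 3.

Cell `pub-hodge-ring2`, seat `motiv` (generation 5), unit `pub-hodge-ring2-motiv-g5`; serves the open item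
stmt-HodgeConjecture-1333 (`PadicSemiregularLift.HodgeAbelianVarieties`, "HC_AV") as a helper and the atlas
of complex abelian varieties of dimension `≤ 7` (KIND column for the hypothesis HC_CM).

HC_CM is, everywhere in this programme, the BINDER `RankFourFaces.CMAbelianHodge` (item
stmt-HodgeConjecture-3052) BY NAME — never a new declaration, never a cited fact. THIS FILE DOES NOT USE IT:
the point is that on the cells below its instance is DISCHARGED by print.

## The cells

Part V (`Theorems/Ring2MotivProductCells`) typed the generic product cell
`ProdCMCell 𝒜 𝒞 X := ∃ A C, X ~ A × C ∧ 𝒜 A ∧ IsOfCMType C ∧ 𝒞 C` with its splitting hypothesis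
`CellProductSpan 𝒜` (`Hg(A × C) = Hg(A) × Hg(C)`-consequence "Hodge classes of `A × C` are spanned by products",
discharged from Gordon's App. B §3 when `Hg(A)` is semisimple or from Lombardo's Lemma 3.4 when `A` has no
type-IV factor — both refereed facts, kept as binders `hG` / `hL`), and proved the EXACTNESS
`HC(cell) ↔ HC(𝒜) ∧ HC(CM ∩ 𝒞)`.

Here `𝒞 := DiscOneWeilPowerClass` — `C` is isogenous to a power `C₀^(k+1)` of a complex abelian fourfold `C₀`
of Weil type with DISCRIMINANT 1 (Literature Part VI's predicate `IsDiscOneWeilFourfold C₀` = the hypothesis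
list of the tree's refereed fact `FloccariFu2026_hodgeClasses_algebraic_powers_discOneWeilFourfold`,
Floccari–Fu, J. Math. Pures Appl. 210 (2026) 103876, Theorem 1.2: HC for all powers of every abelian fourfold
of Weil type with discriminant 1; print's definition has no genericity condition, so CM members are covered).
On this `𝒞` the CM-side conjunct `HC(CM ∩ 𝒞)` is a THEOREM modulo the Floccari–Fu binder `h5`
(`hodgeConjectureFor_of_discOneWeilPowerClass`), hence:

* `hodgeConjectureFor_of_prodCMCell_discOneWeilPower` — KIND = ABSENT: `HC(𝒜) ⟹ HC(𝒜 × (CM ∩ 𝒞))` on a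
  split class (`…_of_gordon`: `Hg` semisimple on `𝒜`; `…_of_lombardo`: no type-IV factor on `𝒜`);
* CLOSED OUTRIGHT sub-cells: `𝒜 ⊆ {dim ≤ 3}` (`…_dim_le_three_…`, the tree's unconditional HC in dimension
  `≤ 3`) and `𝒜 ⊆ IsDivisorGenerated` (`…_isDivisorGenerated_…`) — e.g. (threefold with semisimple `Hg`) ×
  (CM discriminant-1 Weil fourfold)^(k+1), dimensions `7, 11, 15, …`, with NO hypothesis beyond the two
  refereed binders;
* EXACTNESS `forall_prodCMCell_discOneWeilPower_iff`: given one CM member of `𝒞`,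
  `HC(cell) ↔ HC(𝒜)` — the cell carries exactly the content of HC on the non-CM side; in particular for
  `𝒜 = ⊤ ∩ split` nothing is gained or lost by the CM factor;
* the DISCHARGE itself on summit carriers: `cmHodgeHypothesisAt_of_discOneWeilPowerClass` (Milne's
  hypothesis at every member of `𝒞`, CM or not);
* ON-PATH (mandatory): `…_of_hodgeConjecture`, `…_of_hodgeAbelianVarieties`.

What is NOT claimed: which CM fourfolds are members of `𝒞` (a CM abelian fourfold `C₀` with an imaginary
quadratic `k ⊆ End⁰ C₀` acting with multiplicities `(2,2)` is of Weil type; whether SOME polarization makes the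
discriminant 1 is print-level reading, RING2-MAP `## §motiv (gen 5)`, and stays the binder
`IsDiscOneWeilFourfold C₀`); nothing about Weil-type CM factors of discriminant `≠ 1` (KIND = LOAD-BEARING,
Part IV/V rows `…_of_cmAbelianHodge…`); nothing about non-split products.

References (bib keys): FloccariFu2026 (Thm. 1.2), Gordon1999HodgeAVSurvey (App. B §3), Lombardo2016
(Lemma 3.4), MoonenZarhin1999LowDim (Thm. 0.1, §3 (3.1)), vanGeemen1994HodgeAV (Lemma 5.2, Thm. 4.6),
Milne1999 (§7 (H)), Deligne2000 (§1), Fulton1998 (Example 10.1.2).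
-/

set_option linter.dupNamespace false

namespace Summit.HodgeConjecture.HodgeConjecture.Ring2.Motiv

open CategoryTheory
open Literature.AlgebraicGeometry Literature.AlgebraicGeometry.Motives
open Literature.AlgebraicGeometry.HodgeTheory
open Literature.AlgebraicGeometry.Milne1999
open Summit.HodgeConjecture.HodgeConjecture.Theses

variable {𝒜 : AbelianVariety ℂ → Prop}

/-! ## §0 The CM-side class -/

/-- **`DiscOneWeilPowerClass C`**: `C` is isogenous to a power `C₀^(k+1)` (`k ≥ 0`) of a complex abelian fourfold
`C₀` of Weil type with discriminant 1 (Part VI's `IsDiscOneWeilFourfold`). Nothing asserted.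
[cite: FloccariFu2026, Theorem 1.2] -/
def DiscOneWeilPowerClass (C : AbelianVariety ℂ) : Prop :=
  ∃ (C₀ : AbelianVariety ℂ) (k : ℕ), IsDiscOneWeilFourfold C₀ ∧ AbelianVariety.IsIsogenous C (C₀.powSucc k)

/-- Powers of a member are in the class. [folklore] -/
theorem discOneWeilPowerClass_powSucc {C₀ : AbelianVariety ℂ} (hC : IsDiscOneWeilFourfold C₀) (k : ℕ) :
    DiscOneWeilPowerClass (C₀.powSucc k) :=
  ⟨C₀, k, hC, AbelianVariety.IsIsogenous.refl _⟩

/-- A discriminant-1 Weil fourfold is in the class (`k = 0`). [folklore] -/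
theorem discOneWeilPowerClass_of_isDiscOneWeilFourfold {C₀ : AbelianVariety ℂ} (hC : IsDiscOneWeilFourfold C₀) :
    DiscOneWeilPowerClass C₀ :=
  discOneWeilPowerClass_powSucc hC 0

/-- The class is isogeny-closed. [folklore] -/
theorem discOneWeilPowerClass_of_isIsogenous {C C' : AbelianVariety ℂ} (hCC' : AbelianVariety.IsIsogenous C C')
    (hC' : DiscOneWeilPowerClass C') : DiscOneWeilPowerClass C := by
  obtain ⟨C₀, k, hC₀, hi⟩ := hC'
  exact ⟨C₀, k, hC₀, hCC'.trans hi⟩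

/-! ## §1 The discharge: HC and Milne's hypothesis hold on the class (modulo the Floccari–Fu binder) -/

/-- **HC on the CM side of the cell is a theorem in print**: every member of `DiscOneWeilPowerClass` satisfies HC,
modulo the refereed Floccari–Fu fact (binder `h5`). [cite: FloccariFu2026, Theorem 1.2] -/
theorem hodgeConjectureFor_of_discOneWeilPowerClass
    (h5 : FloccariFu2026_hodgeClasses_algebraic_powers_discOneWeilFourfold) (C : AbelianVariety ℂ)
    (hC : DiscOneWeilPowerClass C) : HodgeConjectureFor C.dim C.X := by
  obtain ⟨C₀, k, hC₀, hi⟩ := hC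
  exact hodgeConjectureFor_of_isIsogenous_powSucc_of_isDiscOneWeilFourfold h5 C₀ hC₀ k hi

/-- **HC_CM's instance DISCHARGED on the class** (summit-side restatement of Part VI): Milne's hypothesis at every
member, CM or not. [cite: FloccariFu2026, Theorem 1.2] [cite: Milne1999, §7 p. 72] -/
theorem cmHodgeHypothesisAt_of_discOneWeilPowerClass
    (h5 : FloccariFu2026_hodgeClasses_algebraic_powers_discOneWeilFourfold) {C : AbelianVariety ℂ}
    (hC : DiscOneWeilPowerClass C) : CMHodgeHypothesisAt C :=
  fun _ _ ↦ hodgeConjectureFor_of_discOneWeilPowerClass h5 C hC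

/-- The CM-side conjunct of Part V's exactness, discharged. [cite: FloccariFu2026, Theorem 1.2] -/
theorem forall_cm_discOneWeilPowerClass_hodgeConjectureFor
    (h5 : FloccariFu2026_hodgeClasses_algebraic_powers_discOneWeilFourfold) :
    ∀ C : AbelianVariety ℂ, IsOfCMType C → DiscOneWeilPowerClass C → HodgeConjectureFor C.dim C.X :=
  fun C _ hC ↦ hodgeConjectureFor_of_discOneWeilPowerClass h5 C hC

/-! ## §2 KIND = ABSENT: the product cells -/

/-- **The cell theorem** — on a split class `𝒜`, `HC(𝒜) ⟹ HC(𝒜 × (CM ∩ DiscOneWeilPower))`; NO HC_CM.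
[cite: FloccariFu2026, Theorem 1.2] [cite: MoonenZarhin1999LowDim, §3 (3.1)] -/
theorem hodgeConjectureFor_of_prodCMCell_discOneWeilPower (hS : CellProductSpan 𝒜)
    (h5 : FloccariFu2026_hodgeClasses_algebraic_powers_discOneWeilFourfold)
    (h𝒜 : ∀ A : AbelianVariety ℂ, 𝒜 A → HodgeConjectureFor A.dim A.X)
    {X : AbelianVariety ℂ} (hX : ProdCMCell 𝒜 DiscOneWeilPowerClass X) : HodgeConjectureFor X.dim X.X :=
  hodgeConjectureFor_of_prodCMCell_of_left_of_right hS h𝒜 (forall_cm_discOneWeilPowerClass_hodgeConjectureFor h5) hX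

/-- **… with the splitting discharged by Gordon's fact** (`Hg` semisimple on `𝒜`).
[cite: Gordon1999HodgeAVSurvey, App. B §3] [cite: FloccariFu2026, Theorem 1.2] -/
theorem hodgeConjectureFor_of_prodCMCell_discOneWeilPower_of_gordon
    (hG : Gordon1999_hodgeClassesProductSpan_of_semisimple)
    (h5 : FloccariFu2026_hodgeClasses_algebraic_powers_discOneWeilFourfold)
    (h𝒜s : ∀ A, 𝒜 A → HasSemisimpleHodgeGroup A)
    (h𝒜 : ∀ A : AbelianVariety ℂ, 𝒜 A → HodgeConjectureFor A.dim A.X)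
    {X : AbelianVariety ℂ} (hX : ProdCMCell 𝒜 DiscOneWeilPowerClass X) : HodgeConjectureFor X.dim X.X :=
  hodgeConjectureFor_of_prodCMCell_discOneWeilPower (cellProductSpan_of_gordon hG h𝒜s) h5 h𝒜 hX

/-- **… with the splitting discharged by Lombardo's fact** (no type-IV factor on `𝒜`).
[cite: Lombardo2016, Lemma 3.4] [cite: FloccariFu2026, Theorem 1.2] -/
theorem hodgeConjectureFor_of_prodCMCell_discOneWeilPower_of_lombardo
    (hL : Lombardo2016_hodgeClassesProductSpan)
    (h5 : FloccariFu2026_hodgeClasses_algebraic_powers_discOneWeilFourfold)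
    (h𝒜4 : ∀ A, 𝒜 A → HasNoTypeIVFactor A)
    (h𝒜 : ∀ A : AbelianVariety ℂ, 𝒜 A → HodgeConjectureFor A.dim A.X)
    {X : AbelianVariety ℂ} (hX : ProdCMCell 𝒜 DiscOneWeilPowerClass X) : HodgeConjectureFor X.dim X.X :=
  hodgeConjectureFor_of_prodCMCell_discOneWeilPower (cellProductSpan_of_lombardo hL h𝒜4) h5 h𝒜 hX

/-- **CLOSED OUTRIGHT: `𝒜 ⊆ {dim ≤ 3}`, split** — e.g. (abelian threefold with semisimple `Hg`) ×
(CM discriminant-1 Weil fourfold)^(k+1): dimensions `7, 11, …`; no hypothesis beyond the refereed binders.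
[cite: MoonenZarhin1999LowDim, Thm. (3.2)] [cite: FloccariFu2026, Theorem 1.2] -/
theorem hodgeConjectureFor_of_prodCMCell_dim_le_three_discOneWeilPower (hS : CellProductSpan 𝒜)
    (h5 : FloccariFu2026_hodgeClasses_algebraic_powers_discOneWeilFourfold) (h𝒜3 : ∀ A, 𝒜 A → A.dim ≤ 3)
    {X : AbelianVariety ℂ} (hX : ProdCMCell 𝒜 DiscOneWeilPowerClass X) : HodgeConjectureFor X.dim X.X :=
  hodgeConjectureFor_of_prodCMCell_discOneWeilPower hS h5
    (fun A hA ↦ hodgeConjectureFor_of_dim_le_three_holds (h𝒜3 A hA) AbelianVariety.isSmoothProjective_holds) hX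

/-- **CLOSED OUTRIGHT: semisimple `Hg` of dimension `≤ 3` times (CM ∩ DiscOneWeilPower)** — both splitting and
HC(`𝒜`) discharged; only the two refereed binders remain. [cite: Gordon1999HodgeAVSurvey, App. B §3]
[cite: FloccariFu2026, Theorem 1.2] [cite: MoonenZarhin1999LowDim, Thm. (3.2)] -/
theorem hodgeConjectureFor_of_prodCMCell_semisimple_dim_le_three_discOneWeilPower_of_gordon
    (hG : Gordon1999_hodgeClassesProductSpan_of_semisimple)
    (h5 : FloccariFu2026_hodgeClasses_algebraic_powers_discOneWeilFourfold) {X : AbelianVariety ℂ}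
    (hX : ProdCMCell (fun A ↦ HasSemisimpleHodgeGroup A ∧ A.dim ≤ 3) DiscOneWeilPowerClass X) :
    HodgeConjectureFor X.dim X.X :=
  hodgeConjectureFor_of_prodCMCell_dim_le_three_discOneWeilPower
    (cellProductSpan_of_gordon hG fun _ h ↦ h.1) h5 (fun _ h ↦ h.2) hX

/-- **CLOSED OUTRIGHT: `𝒜 ⊆ IsDivisorGenerated`, split** (e.g. powers of a non-CM elliptic curve, generic
principally polarised abelian varieties, times a CM discriminant-1 Weil fourfold power).
[cite: vanGeemen1994HodgeAV, Thm. 4.6] [cite: FloccariFu2026, Theorem 1.2] -/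
theorem hodgeConjectureFor_of_prodCMCell_isDivisorGenerated_discOneWeilPower (hS : CellProductSpan 𝒜)
    (h5 : FloccariFu2026_hodgeClasses_algebraic_powers_discOneWeilFourfold)
    (h𝒜D : ∀ A, 𝒜 A → IsDivisorGenerated A)
    {X : AbelianVariety ℂ} (hX : ProdCMCell 𝒜 DiscOneWeilPowerClass X) : HodgeConjectureFor X.dim X.X :=
  hodgeConjectureFor_of_prodCMCell_discOneWeilPower hS h5
    (fun A hA ↦ hodgeConjectureFor_of_isDivisorGenerated A (h𝒜D A hA)) hX

/-! ## §3 EXACTNESS: the cell is exactly as hard as HC on `𝒜` -/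

/-- **EXACTNESS** — on a split class, given ONE CM member of the class (binder `hC₀`; e.g. a CM abelian fourfold of
discriminant-1 Weil type — existence is print-level reading and stays a binder):
`HC(𝒜 × (CM ∩ DiscOneWeilPower)) ↔ HC(𝒜)`. The CM factor neither adds nor removes content.
[cite: FloccariFu2026, Theorem 1.2] [cite: MoonenZarhin1999LowDim, §3 (3.1)] [cite: Fulton1998, §10.1 Example 10.1.2] -/
theorem forall_prodCMCell_discOneWeilPower_iff (hS : CellProductSpan 𝒜)
    (h5 : FloccariFu2026_hodgeClasses_algebraic_powers_discOneWeilFourfold)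
    (hC₀ : ∃ C : AbelianVariety ℂ, IsOfCMType C ∧ DiscOneWeilPowerClass C) :
    (∀ X : AbelianVariety ℂ, ProdCMCell 𝒜 DiscOneWeilPowerClass X → HodgeConjectureFor X.dim X.X) ↔
      ∀ A : AbelianVariety ℂ, 𝒜 A → HodgeConjectureFor A.dim A.X :=
  ⟨fun h A hA ↦ hodgeConjectureFor_left_of_prodCMCell hC₀ h A hA,
    fun h𝒜 _ hX ↦ hodgeConjectureFor_of_prodCMCell_discOneWeilPower hS h5 h𝒜 hX⟩

/-- **EXACTNESS, semisimple side discharged by Gordon** (`𝒜 ⊆ HasSemisimpleHodgeGroup`).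
[cite: Gordon1999HodgeAVSurvey, App. B §3] [cite: FloccariFu2026, Theorem 1.2] -/
theorem forall_prodCMCell_discOneWeilPower_iff_of_gordon
    (hG : Gordon1999_hodgeClassesProductSpan_of_semisimple)
    (h5 : FloccariFu2026_hodgeClasses_algebraic_powers_discOneWeilFourfold)
    (h𝒜s : ∀ A, 𝒜 A → HasSemisimpleHodgeGroup A)
    (hC₀ : ∃ C : AbelianVariety ℂ, IsOfCMType C ∧ DiscOneWeilPowerClass C) :
    (∀ X : AbelianVariety ℂ, ProdCMCell 𝒜 DiscOneWeilPowerClass X → HodgeConjectureFor X.dim X.X) ↔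
      ∀ A : AbelianVariety ℂ, 𝒜 A → HodgeConjectureFor A.dim A.X :=
  forall_prodCMCell_discOneWeilPower_iff (cellProductSpan_of_gordon hG h𝒜s) h5 hC₀

/-- **Descent to the non-CM factor needs nothing** (no splitting, no Floccari–Fu): HC on the cell gives HC on `𝒜`
as soon as the class has a CM member. [cite: Fulton1998, §10.1 Example 10.1.2] -/
theorem hodgeConjectureFor_left_of_prodCMCell_discOneWeilPower
    (hC₀ : ∃ C : AbelianVariety ℂ, IsOfCMType C ∧ DiscOneWeilPowerClass C)
    (h : ∀ X : AbelianVariety ℂ, ProdCMCell 𝒜 DiscOneWeilPowerClass X → HodgeConjectureFor X.dim X.X)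
    (A : AbelianVariety ℂ) (hA : 𝒜 A) : HodgeConjectureFor A.dim A.X :=
  hodgeConjectureFor_left_of_prodCMCell hC₀ h A hA

/-! ## §4 On path (mandatory): every row is an instance of the Hodge conjecture -/

/-- **ON-PATH: `HC_AV → HC(cell)`** (item stmt-HodgeConjecture-1333 by name). [cite: Deligne2000, §1] -/
theorem hodgeConjectureFor_of_prodCMCell_discOneWeilPower_of_hodgeAbelianVarieties
    (h : PadicSemiregularLift.HodgeAbelianVarieties) {X : AbelianVariety ℂ}
    (hX : ProdCMCell 𝒜 DiscOneWeilPowerClass X) : HodgeConjectureFor X.dim X.X :=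
  hodgeConjectureFor_of_prodCMCell_of_hodgeAbelianVarieties h hX

/-- **ON-PATH: `HodgeConjecture → HC(cell)`**. [cite: Deligne2000, §1] -/
theorem hodgeConjectureFor_of_prodCMCell_discOneWeilPower_of_hodgeConjecture (h : _root_.HodgeConjecture)
    {X : AbelianVariety ℂ} (hX : ProdCMCell 𝒜 DiscOneWeilPowerClass X) : HodgeConjectureFor X.dim X.X :=
  hodgeConjectureFor_of_prodCMCell_of_hodgeConjecture h hX

/-- **ON-PATH: `HodgeConjecture →` both sides of the exactness.** [cite: Deligne2000, §1] -/
theorem forall_prodCMCell_discOneWeilPower_and_left_of_hodgeConjecture (h : _root_.HodgeConjecture) :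
    (∀ X : AbelianVariety ℂ, ProdCMCell 𝒜 DiscOneWeilPowerClass X → HodgeConjectureFor X.dim X.X) ∧
      ∀ A : AbelianVariety ℂ, 𝒜 A → HodgeConjectureFor A.dim A.X :=
  ⟨fun _ hX ↦ hodgeConjectureFor_of_prodCMCell_of_hodgeConjecture h hX,
    fun A _ ↦ hodgeConjectureFor_of_hodgeConjecture' h A⟩

end Summit.HodgeConjecture.HodgeConjecture.Ring2.Motiv
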